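import Summits.PneNP.PneNP.Theses.LyapunovRefutations

/-!
# Route LyapunovRefutations — `LayeredCertComplete` (stmt-PneNP-10251)

COMPLETENESS of layered max-linear certificates (the converse Lyapunov theorem in this class; card P1): every
unsatisfiable `φ` has a layered certificate — one node per layer, and at layer `j` the pieces `(1, w^β)` with
`w^β_i = [clause i is satisfied by β on the variables ≥ j]`, `β` ranging over the assignments of the `n = φ.numVars`
variables (Tsitsiklis–Blondel's brute-force "all products contract" certificate).

* (PC+L1) along the (unique) path of a word `w`: the piece of `β'` at layer `j+1` is dominated, after the layer-`j`
  transition of `w`, by the piece of `β = β'[j ↦ w j]` at layer `j` (a clause hit by `(j, w j)` contributes its whole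
  mass on both sides; otherwise satisfaction from `j+1` on by `β'` implies satisfaction from `j` on by `β`).
* (L2) at the leaf layer every piece has slope `1` in `x.1` and nonnegative clause weights.
* (L3) at the root `∑ᵢ w^β_i` counts the clauses satisfied by `β`, which is `< m` because `φ` is unsatisfiable.
[TsitsiklisBlondel1997; AhmadiEtAl2014]
-/

set_option linter.dupNamespace false -- `Summit.PneNP.PneNP.…`: summit = sub-problem name (D-0017 single-conjunct layout)

namespace Summit.PneNP.PneNP.Theorems

open Literature.Computability.Complexity

/-- **Support item `LayeredCertComplete` of route LyapunovRefutations (stmt-PneNP-10251)**: every unsatisfiable CNF has a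
layered max-linear certificate (one node per layer; pieces `(1, w^β)` indexed by the assignments `β` of the `numVars`
variables, `w^β_i = [clause i satisfied by β on the variables ≥ j]`). Guards the route's rungs against vacuity.
[cite: TsitsiklisBlondel1997] [cite: AhmadiEtAl2014] -/
theorem lyapunovRefutations_layeredCertComplete_proof :
    Summit.PneNP.PneNP.Theses.LyapunovRefutations.LayeredCertComplete := by
  unfold Summit.PneNP.PneNP.Theses.LyapunovRefutations.LayeredCertComplete
  intro φ hφ
  classical
  -- total extension of an assignment of the variables `< numVars`
  let ext : (Fin φ.numVars → Bool) → ℕ → Bool := fun β v => if h : v < φ.numVars then β ⟨v, h⟩ else false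
  -- clause `i` is satisfied by `β` on the variables `≥ j`
  let Sat : ℕ → (Fin φ.numVars → Bool) → Fin φ.length → Prop := fun j β i =>
    ∃ l ∈ (φ[i] : Clause ℕ), j ≤ l.1 ∧ ext β l.1 = l.2
  let piece : ℕ → (Fin φ.numVars → Bool) → ℚ × (Fin φ.length → ℚ) := fun j β =>
    (1, fun i => if Sat j β i then 1 else 0)
  let P : ℕ → ℕ → List (ℚ × (Fin φ.length → ℚ)) := fun j _ =>
    (Finset.univ : Finset (Fin φ.numVars → Bool)).toList.map (piece j)
  have hmemP : ∀ j v β, piece j β ∈ P j v := fun j v β =>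
    List.mem_map.2 ⟨β, Finset.mem_toList.2 (Finset.mem_univ β), rfl⟩
  have hPmem : ∀ j v q, q ∈ P j v → ∃ β, q = piece j β := fun j v q hq => by
    obtain ⟨β, _, rfl⟩ := List.mem_map.1 hq
    exact ⟨β, rfl⟩
  refine ⟨fun _ => 1, P, ?_, ?_, ?_⟩
  · -- (PC+L1): one node per layer; pull back along `β'[j ↦ w j]`
    intro w
    refine ⟨fun _ => 0, fun j _ => Nat.zero_lt_one, ?_⟩
    intro j hj x _hx1 hx2 q' hq'
    obtain ⟨β', rfl⟩ := hPmem (j + 1) 0 q' hq'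
    let β : Fin φ.numVars → Bool := Function.update β' ⟨j, hj⟩ (w j)
    refine ⟨piece j β, hmemP j 0 β, ?_⟩
    have e1 : (piece (j + 1) β').1 = 1 := rfl
    have e2 : ∀ i, (piece (j + 1) β').2 i = if Sat (j + 1) β' i then 1 else 0 := fun i => rfl
    have e3 : (piece j β).1 = 1 := rfl
    have e4 : ∀ i, (piece j β).2 i = if Sat j β i then 1 else 0 := fun i => rfl
    simp only [e1, e2, e3, e4, one_mul]
    rw [add_assoc, ← Finset.sum_add_distrib]
    refine add_le_add le_rfl ?_
    refine Finset.sum_le_sum fun i _ => ?_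
    have hextj : ext β j = w j := by simp [ext, β, hj]
    by_cases h : ((j, w j) : ℕ × Bool) ∈ φ[i]
    · have hsat : Sat j β i := ⟨(j, w j), h, le_rfl, hextj⟩
      rw [if_pos h, if_pos h, if_pos hsat, mul_zero, add_zero, one_mul]
    · rw [if_neg h, if_neg h, zero_add]
      refine mul_le_mul_of_nonneg_right ?_ (hx2 i)
      by_cases hs : Sat (j + 1) β' i
      · have hsat : Sat j β i := by
          obtain ⟨l, hl, hjl, hβl⟩ := hs
          refine ⟨l, hl, Nat.le_of_succ_le hjl, ?_⟩
          have hne : l.1 ≠ j := by omega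
          have hext : ext β l.1 = ext β' l.1 := by
            simp only [ext]
            split_ifs with hlt
            · have hne' : (⟨l.1, hlt⟩ : Fin φ.numVars) ≠ ⟨j, hj⟩ := fun h' =>
                hne (by simpa using congrArg Fin.val h')
              show Function.update β' ⟨j, hj⟩ (w j) ⟨l.1, hlt⟩ = β' ⟨l.1, hlt⟩
              exact Function.update_of_ne hne' _ _
            · rfl
          rw [hext]
          exact hβl
        rw [if_pos hs, if_pos hsat]
      · rw [if_neg hs]
        split_ifs <;> norm_num
  · -- (L2): every leaf piece dominates `x.1`
    intro v _hv x _hx1 hx2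
    refine ⟨piece φ.numVars (fun _ => false), hmemP φ.numVars v (fun _ => false), ?_⟩
    have e5 : (piece φ.numVars (fun _ => false)).1 = 1 := rfl
    have e6 : ∀ i, (piece φ.numVars (fun _ => false)).2 i = if Sat φ.numVars (fun _ => false) i then 1 else 0 :=
      fun i => rfl
    simp only [e5, e6, one_mul]
    refine le_add_of_nonneg_right (Finset.sum_nonneg fun i _ => mul_nonneg ?_ (hx2 i))
    split_ifs <;> norm_num
  · -- (L3): a root piece counts the clauses satisfied by `β`, fewer than `m` since `φ` is unsatisfiable
    intro v _hv q hq
    obtain ⟨β, rfl⟩ := hPmem 0 v q hq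
    have e7 : ∀ i, (piece 0 β).2 i = if Sat 0 β i then 1 else 0 := fun i => rfl
    simp only [e7]
    have hex : ∃ c ∈ φ, ¬ Clause.eval (ext β) c = true := by
      by_contra hall
      push Not at hall
      exact hφ ⟨ext β, (CNF.eval_eq_true_iff φ (ext β)).2 hall⟩
    obtain ⟨c, hc, hcf⟩ := hex
    obtain ⟨k, hk, hck⟩ := List.getElem_of_mem hc
    have hnot : ¬ Sat 0 β ⟨k, hk⟩ := by
      rintro ⟨l, hl, -, hβl⟩
      apply hcf
      rw [← hck]
      exact List.any_eq_true.2 ⟨l, hl, by simpa [Literal.eval] using hβl⟩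
    have hle1 : ∀ i ∈ (Finset.univ : Finset (Fin φ.length)), (if Sat 0 β i then (1 : ℚ) else 0) ≤ 1 :=
      fun i _ => by split_ifs <;> norm_num
    have hlt1 : ∃ i ∈ (Finset.univ : Finset (Fin φ.length)), (if Sat 0 β i then (1 : ℚ) else 0) < 1 :=
      ⟨⟨k, hk⟩, Finset.mem_univ _, by rw [if_neg hnot]; norm_num⟩
    calc ∑ i, (if Sat 0 β i then (1 : ℚ) else 0) < ∑ _i : Fin φ.length, (1 : ℚ) := Finset.sum_lt_sum hle1 hlt1
      _ = (φ.length : ℚ) := by simp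

end Summit.PneNP.PneNP.Theorems
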